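import Summits.AtomisticToContinuum.FouriersLaw.Theorems.BondHeatUncertaintySubdiffusiveBondHeatJunctionRatioTransferBound
import Summits.AtomisticToContinuum.FouriersLaw.Theorems.BondHeatUncertaintySubdiffusiveBondHeatJunctionRatioSiteMarginal

/-!
# BondHeatUncertainty › SubdiffusiveBondHeat › JunctionRatio › TransferMoment

**[LM] `TransferMoment` PROVED** (`transferMoment_holds`), closing the rank-3 leaf `TransferMoment` of
`JunctionRatioFirstBondBracket` outright: with `N₂ = 3` and the explicit, `N`-independent bound
`M = transferMomentBound ω₂ λ β γ T = 2⁴² kPsi² (1 + 3 C₈(T) + 3 · 105 T⁴)`, both `Ψ_T(0,1)` and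
`Ψ_T(N−1,N−2)` are in `L²(μ_T^N)` with `∫ Ψ² dμ_T^N ≤ M` for every `N ≥ 3` — from the pointwise bound
`Ψ_hot² ≤ 2⁴² kPsi² (1 + q₀⁸ + q₁⁸ + q₂⁸ + p₀⁸ + p₁⁸ + p₂⁸)` (`TransferBound`), the uniform eighth moments
(`SiteMarginal`), and the reflection `Ψ_cold = Ψ_hot ∘ R` (`TransferCalculus`) with `R`-invariance of `μ_T`.

Corollaries = the door theorems of `JunctionRatioFirstBondBracket` with `TransferMoment` discharged:
`rootPositivity_one_of_bracket' : RR → EP → BI → RootPositivity 1`, `firstBondTransfer_of_bracket : BI →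
FirstBondTransfer`, `boundedResponse_of_bracket_of_peeled_of_escapeInfZero_of_subOhmicBootstrap'` (11071
`BoundedResponse` BY NAME from `(∀ ρ < 1, PeeledLocalityLaw ρ 1)`, RR, EP, BI, `EscapeInfZero`,
`SubOhmicBootstrap`) and `asymptoticSeriesLaw_of_bracket_of_peeled_of_nonBallistic'`.
After this file the open mathematics beneath `RootPositivity 1` on the line of record is [BI]
`FirstBondBracket` alone (supports [RR] r4, [EP] r4). [statics; frame]
-/

noncomputable section

open MeasureTheory Filter Topology Set
open scoped BigOperators ENNReal

namespace Summit.AtomisticToContinuum.FouriersLaw.Theorems.SubdiffusiveBondHeat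

namespace EscapeGrading

open Literature.MathematicalPhysics.KineticTheory.HeatConduction
open Summit.AtomisticToContinuum.FouriersLaw.Theses.BondHeatUncertainty (BoundedResponse NonBallistic)
open Summit.AtomisticToContinuum.FouriersLaw.Theorems.SubdiffusiveBondHeat.JunctionDefectGrading

/-! ## J. Assembly: `TransferMoment` -/

section Assembly

variable {ω₂ lam β γ : ℝ}

/-- The uniform bound `M(ω₂, λ, β, γ, T)` of `TransferMomentAt`. -/
def transferMomentBound (ω₂ lam β γ T : ℝ) : ℝ :=
  2 ^ 42 * kPsi ω₂ lam β γ ^ 2 * (1 + 3 * posEighthConst ω₂ lam β γ T + 3 * (105 * T ^ 4))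

/-- **Hot end:** `Ψ_hot ∈ L²(μ_T^N)` and `∫ Ψ_hot² dμ_T^N ≤ M`, every `N ≥ 3`. [statics] -/
theorem transferObservableHot_memLp_and_integral_sq_le (hω : 0 < ω₂) (hl : 0 < lam) (hβ : 0 < β)
    (hγ : 0 < γ) {T : ℝ} (hT : 0 < T) (N : ℕ) (hN : 3 ≤ N) :
    MemLp (transferObservableHot ω₂ lam β γ N hN) 2 ((pinnedChain ω₂ lam β γ).gibbsMeasure N T) ∧
      ∫ x, transferObservableHot ω₂ lam β γ N hN x ^ 2 ∂((pinnedChain ω₂ lam β γ).gibbsMeasure N T) ≤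
        transferMomentBound ω₂ lam β γ T := by
  set μ := (pinnedChain ω₂ lam β γ).gibbsMeasure N T with hμ
  haveI := pinnedChain_isProbabilityMeasure_gibbsMeasure hω hl.le hβ.le γ N hT
  obtain ⟨iq0, mq0⟩ := pinnedChain_position_pow_eight_moment hω hl hβ γ hT N 0 (by omega)
  obtain ⟨iq1, mq1⟩ := pinnedChain_position_pow_eight_moment hω hl hβ γ hT N 1 (by omega)
  obtain ⟨iq2, mq2⟩ := pinnedChain_position_pow_eight_moment hω hl hβ γ hT N 2 (by omega)
  obtain ⟨ip0, mp0⟩ := pinnedChain_momentum_pow_eight_moment hω hl.le hβ.le γ N hT (site0 hN)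
  obtain ⟨ip1, mp1⟩ := pinnedChain_momentum_pow_eight_moment hω hl.le hβ.le γ N hT (site1 hN)
  obtain ⟨ip2, mp2⟩ := pinnedChain_momentum_pow_eight_moment hω hl.le hβ.le γ N hT (site2 hN)
  have iq0' : Integrable (fun x : PhaseSpace N => x.1 (site0 hN) ^ 8) μ := iq0
  have iq1' : Integrable (fun x : PhaseSpace N => x.1 (site1 hN) ^ 8) μ := iq1
  have iq2' : Integrable (fun x : PhaseSpace N => x.1 (site2 hN) ^ 8) μ := iq2
  set c : ℝ := 2 ^ 42 * kPsi ω₂ lam β γ ^ 2 with hc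
  have hc0 : 0 ≤ c := by positivity
  -- the dominating function
  set B : PhaseSpace N → ℝ := fun x => c * (1 + x.1 (site0 hN) ^ 8 + x.1 (site1 hN) ^ 8
    + x.1 (site2 hN) ^ 8 + x.2 (site0 hN) ^ 8 + x.2 (site1 hN) ^ 8 + x.2 (site2 hN) ^ 8) with hB
  have i1 : Integrable (fun _ : PhaseSpace N => (1 : ℝ)) μ := integrable_const _
  have iS1 : Integrable (fun x : PhaseSpace N => 1 + x.1 (site0 hN) ^ 8) μ := i1.add iq0'
  have iS2 : Integrable (fun x : PhaseSpace N => 1 + x.1 (site0 hN) ^ 8 + x.1 (site1 hN) ^ 8) μ :=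
    iS1.add iq1'
  have iS3 : Integrable (fun x : PhaseSpace N => 1 + x.1 (site0 hN) ^ 8 + x.1 (site1 hN) ^ 8
      + x.1 (site2 hN) ^ 8) μ := iS2.add iq2'
  have iS4 : Integrable (fun x : PhaseSpace N => 1 + x.1 (site0 hN) ^ 8 + x.1 (site1 hN) ^ 8
      + x.1 (site2 hN) ^ 8 + x.2 (site0 hN) ^ 8) μ := iS3.add ip0
  have iS : Integrable (fun x : PhaseSpace N => 1 + x.1 (site0 hN) ^ 8 + x.1 (site1 hN) ^ 8
      + x.1 (site2 hN) ^ 8 + x.2 (site0 hN) ^ 8 + x.2 (site1 hN) ^ 8) μ := iS4.add ip1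
  have iS' : Integrable (fun x : PhaseSpace N => 1 + x.1 (site0 hN) ^ 8 + x.1 (site1 hN) ^ 8
      + x.1 (site2 hN) ^ 8 + x.2 (site0 hN) ^ 8 + x.2 (site1 hN) ^ 8 + x.2 (site2 hN) ^ 8) μ :=
    iS.add ip2
  have iB : Integrable B μ := iS'.const_mul c
  have hle : ∀ x, transferObservableHot ω₂ lam β γ N hN x ^ 2 ≤ B x :=
    fun x => sq_transferObservableHot_le hω.le hl.le hβ.le hγ.le hN x
  have hcont := continuous_transferObservableHot (ω₂ := ω₂) (lam := lam) (γ := γ) hβ.le hN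
  -- integrability of `Ψ²` by domination
  have iΨ2 : Integrable (fun x => transferObservableHot ω₂ lam β γ N hN x ^ 2) μ := by
    refine iB.mono' (by fun_prop) (Filter.Eventually.of_forall fun x => ?_)
    rw [Real.norm_eq_abs, abs_of_nonneg (sq_nonneg _)]
    exact hle x
  refine ⟨(memLp_two_iff_integrable_sq hcont.aestronglyMeasurable).mpr iΨ2, ?_⟩
  have hone : ∫ _ : PhaseSpace N, (1 : ℝ) ∂μ = 1 := by simp
  calc ∫ x, transferObservableHot ω₂ lam β γ N hN x ^ 2 ∂μ
      ≤ ∫ x, B x ∂μ := integral_mono iΨ2 iB hle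
    _ = c * (∫ _ : PhaseSpace N, (1 : ℝ) ∂μ + ∫ x, x.1 (site0 hN) ^ 8 ∂μ + ∫ x, x.1 (site1 hN) ^ 8 ∂μ
          + ∫ x, x.1 (site2 hN) ^ 8 ∂μ + ∫ x, x.2 (site0 hN) ^ 8 ∂μ + ∫ x, x.2 (site1 hN) ^ 8 ∂μ
          + ∫ x, x.2 (site2 hN) ^ 8 ∂μ) := by
        simp only [hB]
        rw [integral_const_mul, integral_add iS ip2, integral_add iS4 ip1, integral_add iS3 ip0,
          integral_add iS2 iq2', integral_add iS1 iq1', integral_add i1 iq0']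
    _ ≤ transferMomentBound ω₂ lam β γ T := by
        rw [hone, transferMomentBound, ← hc]
        refine mul_le_mul_of_nonneg_left ?_ hc0
        have e0 : ∫ x, x.2 (site0 hN) ^ 8 ∂μ = 105 * T ^ 4 := mp0
        have e1 : ∫ x, x.2 (site1 hN) ^ 8 ∂μ = 105 * T ^ 4 := mp1
        have e2 : ∫ x, x.2 (site2 hN) ^ 8 ∂μ = 105 * T ^ 4 := mp2
        have f0 : ∫ x, x.1 (site0 hN) ^ 8 ∂μ ≤ posEighthConst ω₂ lam β γ T := mq0
        have f1 : ∫ x, x.1 (site1 hN) ^ 8 ∂μ ≤ posEighthConst ω₂ lam β γ T := mq1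
        have f2 : ∫ x, x.1 (site2 hN) ^ 8 ∂μ ≤ posEighthConst ω₂ lam β γ T := mq2
        linarith

/-- **Reflection invariance of the Gibbs second moment:** `∫ (g ∘ R)² dμ_T = ∫ g² dμ_T`. [folklore] -/
theorem integral_sq_comp_siteReflection (ω₂ lam β γ T : ℝ) (N : ℕ) (g : PhaseSpace N → ℝ) :
    ∫ x, g (siteReflection N x) ^ 2 ∂((pinnedChain ω₂ lam β γ).gibbsMeasure N T) =
      ∫ x, g x ^ 2 ∂((pinnedChain ω₂ lam β γ).gibbsMeasure N T) := by
  rw [(pinnedChain ω₂ lam β γ).integral_gibbsMeasure (fun x => g (siteReflection N x) ^ 2),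
    (pinnedChain ω₂ lam β γ).integral_gibbsMeasure (fun x => g x ^ 2)]
  congr 1
  have hH : ∀ x, (pinnedChain ω₂ lam β γ).gibbsDensity N T (siteReflection N x) =
      (pinnedChain ω₂ lam β γ).gibbsDensity N T x :=
    fun x => by simp [OscillatorChain.gibbsDensity,
      (pinnedChain ω₂ lam β γ).hamiltonian_siteReflection (pinnedChain_V_neg ω₂ lam β γ) N x]
  have h2 := (SuperadditiveResistance.KuboPlain.measurePreserving_reflM N).integral_comp
    (SuperadditiveResistance.KuboPlain.reflM N).measurableEmbedding
    (fun x => g x ^ 2 * (pinnedChain ω₂ lam β γ).gibbsDensity N T x)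
  simp only [SuperadditiveResistance.KuboPlain.reflM_apply, hH] at h2
  exact h2

/-- **[LM] `TransferMoment` holds.** Uniform Gibbs second moments of the hot and cold
second-order test observables `Ψ_T(0,1)`, `Ψ_T(N−1,N−2)`, with `N₂ = 3` and
`M = transferMomentBound ω₂ λ β γ T`. [statics] -/
theorem transferMoment_holds : TransferMoment := by
  intro ω₂ lam β γ hω hl hβ hγ T hT
  refine ⟨transferMomentBound ω₂ lam β γ T, 3, fun N _ hN => ?_⟩
  obtain ⟨hmem, hint⟩ := transferObservableHot_memLp_and_integral_sq_le hω hl hβ hγ hT N hN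
  have hcont := continuous_transferObservableHot (ω₂ := ω₂) (lam := lam) (γ := γ) hβ.le hN
  have hfun_hot : transferObservable ω₂ lam β γ T N ⟨0, by omega⟩ ⟨1, by omega⟩ =
      transferObservableHot ω₂ lam β γ N hN :=
    funext fun x => transferObservable_hot_eq hN hβ.le T x
  have hfun_cold : transferObservable ω₂ lam β γ T N ⟨N - 1, by omega⟩ ⟨N - 1 - 1, by omega⟩ =
      transferObservableHot ω₂ lam β γ N hN ∘ siteReflection N :=
    funext fun x => transferObservable_cold_eq hN hβ.le T x
  rw [hfun_hot, hfun_cold]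
  refine ⟨hmem, hint, SuperadditiveResistance.KuboPlain.memLp_comp_siteReflection hω hl.le hβ.le hT
    hcont hmem, ?_⟩
  simp only [Function.comp_apply]
  rw [integral_sq_comp_siteReflection]
  exact hint

/-! ## Corollaries: the doors of `JunctionRatioFirstBondBracket` with `[LM]` discharged -/

/-- `RR ∧ EP ∧ BI ⟹ RootPositivity 1` ([LM] is now a theorem). [frame] -/
theorem rootPositivity_one_of_bracket' (hR : ResponseRegularity) (hE : FirstOrderEntropyProduction)
    (hB : FirstBondBracket) : RootPositivity 1 :=
  rootPositivity_one_of_bracket hR hE hB transferMoment_holds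

/-- `BI ⟹ FirstBondTransfer` ([LM] discharged). [frame] -/
theorem firstBondTransfer_of_bracket (hB : FirstBondBracket) : FirstBondTransfer :=
  firstBondTransfer_of_bracket_of_moment hB transferMoment_holds

/-- **11071 BY NAME with [LM] discharged:
`(∀ ρ < 1, PeeledLocalityLaw ρ 1) ∧ RR ∧ EP ∧ BI ∧ EscapeInfZero ∧ SubOhmicBootstrap ⟹ BoundedResponse`.**
[frame] -/
theorem boundedResponse_of_bracket_of_peeled_of_escapeInfZero_of_subOhmicBootstrap'
    (hL : ∀ ρ : ℝ, ρ < 1 → PeeledLocalityLaw ρ 1)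
    (hR : ResponseRegularity) (hE : FirstOrderEntropyProduction) (hB : FirstBondBracket)
    (hI : EscapeInfZero) (hS : SubOhmicBootstrap) : BoundedResponse :=
  boundedResponse_of_bracket_of_peeled_of_escapeInfZero_of_subOhmicBootstrap hL hR hE hB
    transferMoment_holds hI hS

/-- `(∀ ρ < 1, PeeledLocalityLaw ρ 1) ∧ RR ∧ EP ∧ BI ∧ NonBallistic ⟹ AsymptoticSeriesLaw` ([LM]
discharged). [frame] -/
theorem asymptoticSeriesLaw_of_bracket_of_peeled_of_nonBallistic'
    (hL : ∀ ρ : ℝ, ρ < 1 → PeeledLocalityLaw ρ 1)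
    (hR : ResponseRegularity) (hE : FirstOrderEntropyProduction) (hB : FirstBondBracket)
    (hN : NonBallistic) : AsymptoticSeriesLaw :=
  asymptoticSeriesLaw_of_bracket_of_peeled_of_nonBallistic hL hR hE hB transferMoment_holds hN

end Assembly

end EscapeGrading

end Summit.AtomisticToContinuum.FouriersLaw.Theorems.SubdiffusiveBondHeat
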